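import Literature.NumberTheory.Kottwitz1992.HermitianSymmetricSpaces
import Literature.Geometry.Kaehler.ComplexTorusOfComplexStructure      -- ★ `CxModule J hJ`: `(W, J)` as a `ℂ`-vector space
import HarnessLib

/-!
# Discharge for the carpet `Kottwitz1992/HermitianSymmetricSpaces` (§4): the case `D = ℝ` of the classification on p. 386

`Kottwitz1992_4_class_real_holds : HermitianSymmetricSpaces.Kottwitz1992_4_class_real` (ED. 1).

Topic `Literature/NumberTheory/Kottwitz1992`; namespace `Literature.NumberTheory.Kottwitz1992.HermitianSymmetricSpacesHolds`
(squad TK precedent `KottwitzTriplesHolds` ∕ `FixedPointCountHolds`: the carpet `HermitianSymmetricSpaces` stays statements-only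
with its import closure; the `_holds` of this CLOSED named fact lives in a sibling proof-lane file because the proof imports the
tree's complex-structure module `Literature.Geometry.Kaehler.ComplexTorusOfComplexStructure` (`CxModule`), which the §5
carpet `ModuliProblem` importing `HermitianSymmetricSpaces` should not inherit).
PROOFS ONLY: no definition, no new named fact, no `sorry`, no `axiom`, no `instance`, no `notation` (net debt −1, D-0026).

Source, verbatim (R. E. Kottwitz, *Points on some Shimura varieties over finite fields*, JAMS 5 (1992), §4 p. 386 = held
`paper:doi-10-2307-2152772` p0014 L39–L44): «By Lemma 2.10, classifying `*`-homomorphisms `ℂ → C` up to inner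
automorphisms of `(C, ι)` is the same as classifying `ℝ`-algebra homomorphisms `ℂ → C` up to conjugacy by `C^×`. With
`D = ℝ, ℂ, ℍ` as the case may be, this is the same as classifying isomorphism classes of `ℂ ⊗_ℝ D`-modules that are of
rank `n` as `D`-modules. If `D = ℝ` then `ℂ ⊗_ℝ D = ℂ`, and no `h` exists unless `n` is even, in which case it is unique up
to inner automorphisms of `(C, ι)`.»  The proof below IS the printed argument: an `ℝ`-algebra map `h : ℂ → M_n(ℝ)` is a
`ℂ`-module structure on `ℝⁿ` (the complex structure `J = h(i)`, `J² = −1`: the tree's ★ `CxModule J hJ`), so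
`n = dim_ℝ ℝⁿ = 2 dim_ℂ (ℝⁿ, J)` is even (★ `CxModule.two_mul_finrank`); for even `n = 2r` the `ℂ`-module `ℂ^r` transported
along an `ℝ`-linear `ℂ^r ≅ ℝⁿ` is such an `h`; and two `ℂ`-modules `(ℝⁿ, J)`, `(ℝⁿ, J′)` of the same (complex) dimension
`n ∕ 2` are isomorphic — the complex coordinates ★ `CxModule.coordJ` of both give an `ℝ`-linear automorphism `g` of `ℝⁿ`
with `g J = J′ g`, i.e. `h′(z) = g h(z) g⁻¹` since `h(z) = re z + im z · h(i)`.

## What is proved (all `theorem`s)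

* `toLinAlgEquiv_I_mul_self` — `J = h(i)` (as an endomorphism of `ℝⁿ`) has `J² = −1`.
* `algHom_complex_apply` — every `ℝ`-algebra map `h : ℂ → A` is `h(z) = re z · 1 + im z · h(i)`.
* `even_of_algHom` — an `ℝ`-algebra map `ℂ → M_n(ℝ)` forces `n` even.
* `nonempty_algHom_of_even` — for `n` even there is an `ℝ`-algebra map `ℂ → M_n(ℝ)`.
* `exists_units_conj` — any two `ℝ`-algebra maps `h, h′ : ℂ → M_n(ℝ)` are conjugate under `GL_n(ℝ)`.
* `Kottwitz1992_4_class_real_holds` — the discharge.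

## ED. 2 (append-only): Lemma 4.1 (3), `Kottwitz1992_4_1_3_compact_holds`

Source, verbatim (p. 386 = p0014 L20–L26): «To prove (3) we must show that the group `{x ∈ C ⊗_ℝ ℂ | x x* = 1 and
h(i)⁻¹ x̄ h(i) = x}` is compact. This group is a closed subgroup of the group `{x ∈ C ⊗_ℝ ℂ | x x′ = 1}`, where `x ↦ x′` is
the tensor product of `ι` on `C` and complex conjugation on `ℂ`; the involution `x ↦ x′` is positive (Lemma 2.3), and
therefore the group `{x ∈ C ⊗_ℝ ℂ | x x′ = 1}` is compact, since by choosing a faithful positive definite Hermitian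
`C ⊗_ℝ ℂ`-module, we can embed this group as a closed subgroup of the orthogonal group of a positive definite symmetric
bilinear form.»  The proof below follows the print with the faithful module taken to be `C ⊗_ℝ ℂ` itself under left
multiplication and the positive definite form the trace form of the positive involution: in the carpet's real
coordinates `x = a ⊗ 1 + b ⊗ i`, the conditions `a h(i) = h(i) a`, `h(i) b = −b h(i)` give `ι(a) = a*`, `ι(b) = −b*`
(`iota_eq_star_of_comm`, `iota_eq_neg_star_of_anticomm` — this is «`x′ = x*` on the subgroup»), so `x x* = 1` yields
`a ι(a) + b ι(b) = a a* − b b* = 1` and hence `tr(a ι(a)) + tr(b ι(b)) = tr(1) = dim_ℝ C`: the set lies on a level set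
of the positive definite quadratic form `q(a) + q(b)`, `q(y) = tr_{C/ℝ}(y ι(y))` (positivity of `ι`), on `C × C`; it is
closed (multiplication is continuous for the unique Hausdorff vector-space topology of the finite-dimensional `C`,
Mathlib `IsModuleTopology.continuous_mul_of_finite`), and a closed subset of a level set of a continuous positive definite
quadratic form on a finite-dimensional real vector space is compact (`isCompact_of_subset_levelSet`, through
`ContinuousLinearEquiv.ofFinrankEq` to `ℝ^m` and the minimum of the form on the unit sphere).

* `star_map_I`, `map_I_mul_map_I`, `map_inv_I` — `h(i)* = −h(i)`, `h(i)² = −1`, `h(i⁻¹) = −h(i)`.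
* `iota_eq_star_of_comm`, `iota_eq_neg_star_of_anticomm` — `ι(a) = a*` if `a h(i) = h(i) a`; `ι(b) = −b*` if
  `h(i) b = −b h(i)`.
* `iota_smul` — `ι` is `ℝ`-homogeneous.
* `isCompact_of_subset_levelSet` — the compactness lemma just described.
* `Kottwitz1992_4_1_3_compact_holds` — the discharge.

## References

* [Kottwitz1992] §4 p. 386 (p0014 L39–L44); Lemma 2.10 p. 382.
* [vanGeemen1994HodgeAV] 5.5 (the tree's `CxModule`, cited there).
-/

namespace Literature.NumberTheory.Kottwitz1992.HermitianSymmetricSpacesHolds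

open Literature.NumberTheory.Kottwitz1992.HermitianSymmetricSpaces
open Literature.Geometry.Kaehler Module

variable {n : ℕ}

/-- `J = h(i)`, read as an endomorphism of `ℝⁿ`, is a complex structure: `J ∘ J = −1` (`i² = −1`).
[cite: Kottwitz1992, §4 (p. 386)] -/
theorem toLinAlgEquiv_I_mul_self (h : ℂ →ₐ[ℝ] Matrix (Fin n) (Fin n) ℝ) :
    Matrix.toLinAlgEquiv' (h Complex.I) * Matrix.toLinAlgEquiv' (h Complex.I) = -1 := by
  rw [← map_mul, ← map_mul, Complex.I_mul_I, map_neg, map_one, map_neg, map_one]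

/-- An `ℝ`-algebra homomorphism out of `ℂ` is determined by the image of `i`: `h(z) = re z · 1 + im z · h(i)`.
[cite: Kottwitz1992, §4 (p. 386)] -/
theorem algHom_complex_apply {A : Type*} [Ring A] [Algebra ℝ A] (h : ℂ →ₐ[ℝ] A) (z : ℂ) :
    h z = z.re • (1 : A) + z.im • h Complex.I := by
  conv_lhs => rw [← Complex.re_add_im z]
  rw [map_add, map_mul, show ((z.re : ℝ) : ℂ) = algebraMap ℝ ℂ z.re from rfl,
    show ((z.im : ℝ) : ℂ) = algebraMap ℝ ℂ z.im from rfl, h.commutes, h.commutes,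
    Algebra.algebraMap_eq_smul_one, Algebra.algebraMap_eq_smul_one, smul_mul_assoc, one_mul]

/-- **«no `h` exists unless `n` is even»** (p. 386): an `ℝ`-algebra map `h : ℂ → M_n(ℝ)` makes `ℝⁿ` a `ℂ`-vector space
`(ℝⁿ, h(i))`, so `n = 2 dim_ℂ (ℝⁿ, h(i))`. [cite: Kottwitz1992, §4 (p. 386)] -/
theorem even_of_algHom (h : ℂ →ₐ[ℝ] Matrix (Fin n) (Fin n) ℝ) : Even n := by
  have h2 := CxModule.two_mul_finrank (Matrix.toLinAlgEquiv' (h Complex.I)) (toLinAlgEquiv_I_mul_self h)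
  rw [Module.finrank_fin_fun] at h2
  exact ⟨finrank ℂ (CxModule (Matrix.toLinAlgEquiv' (h Complex.I)) (toLinAlgEquiv_I_mul_self h)), by omega⟩

/-- **For even `n` an `h` exists** (p. 386: «`ℂ ⊗_ℝ D`-modules that are of rank `n` as `D`-modules», `D = ℝ`): transport the
`ℂ`-module `ℂ^r` (`n = 2r`) along an `ℝ`-linear isomorphism `ℂ^r ≅ ℝⁿ` and read the scalar action in `M_n(ℝ)`.
[cite: Kottwitz1992, §4 (p. 386)] -/
theorem nonempty_algHom_of_even (hn : Even n) : Nonempty (ℂ →ₐ[ℝ] Matrix (Fin n) (Fin n) ℝ) := by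
  obtain ⟨r, hr⟩ := hn
  have hfr : finrank ℝ (Fin r → ℂ) = finrank ℝ (Fin n → ℝ) := by
    rw [Module.finrank_pi_fintype, Module.finrank_fin_fun, Finset.sum_const, Finset.card_univ, Fintype.card_fin,
      Complex.finrank_real_complex, smul_eq_mul]
    omega
  let e : (Fin r → ℂ) ≃ₗ[ℝ] (Fin n → ℝ) := LinearEquiv.ofFinrankEq _ _ hfr
  exact ⟨(Matrix.toLinAlgEquiv'.symm : Module.End ℝ (Fin n → ℝ) ≃ₐ[ℝ] Matrix (Fin n) (Fin n) ℝ).toAlgHom.comp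
    ((e.conjAlgEquiv ℝ).toAlgHom.comp (Algebra.lsmul ℝ ℝ (Fin r → ℂ)))⟩

/-- **«unique up to inner automorphisms»** (p. 386): two `ℝ`-algebra maps `h, h′ : ℂ → M_n(ℝ)` are conjugate under
`GL_n(ℝ)` — the `ℂ`-vector spaces `(ℝⁿ, h(i))` and `(ℝⁿ, h′(i))` both have dimension `n ∕ 2`, so complex coordinates on each
compose to an `ℝ`-linear automorphism `g` of `ℝⁿ` with `g h(i) = h′(i) g`, whence `h′(z) = g h(z) g⁻¹` by
`algHom_complex_apply`. [cite: Kottwitz1992, §4 (p. 386)] -/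
theorem exists_units_conj (h h' : ℂ →ₐ[ℝ] Matrix (Fin n) (Fin n) ℝ) :
    ∃ g : (Matrix (Fin n) (Fin n) ℝ)ˣ, ∀ z : ℂ,
      h' z = (g : Matrix (Fin n) (Fin n) ℝ) * h z * (g⁻¹ : (Matrix (Fin n) (Fin n) ℝ)ˣ) := by
  set J := Matrix.toLinAlgEquiv' (h Complex.I) with hJdef
  set J' := Matrix.toLinAlgEquiv' (h' Complex.I) with hJ'def
  have hJ : J * J = -1 := toLinAlgEquiv_I_mul_self h
  have hJ' : J' * J' = -1 := toLinAlgEquiv_I_mul_self h'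
  -- `n = 2k`, `k = dim_ℂ (ℝⁿ, J)`; the same `k` serves `(ℝⁿ, J′)`
  have hk : finrank ℝ (Fin n → ℝ) = 2 * finrank ℂ (CxModule J hJ) := (CxModule.two_mul_finrank J hJ).symm
  let e := CxModule.coordJ J hJ hk
  let e' := CxModule.coordJ J' hJ' hk
  let g : (Fin n → ℝ) ≃ₗ[ℝ] (Fin n → ℝ) := e.trans e'.symm
  have hg : ∀ w, g (J w) = J' (g w) := fun w => by
    show e'.symm (e (J w)) = J' (e'.symm (e w))
    rw [CxModule.coordJ_J, CxModule.coordJ_symm_I_smul]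
  have hgJ : (g : Module.End ℝ (Fin n → ℝ)) * J = J' * (g : Module.End ℝ (Fin n → ℝ)) :=
    LinearMap.ext fun w => by simpa using hg w
  -- transport to matrices along `ψ = (toLinAlgEquiv')⁻¹`
  let ψ : Module.End ℝ (Fin n → ℝ) ≃ₐ[ℝ] Matrix (Fin n) (Fin n) ℝ := Matrix.toLinAlgEquiv'.symm
  have hψJ : ψ J = h Complex.I := Matrix.toLinAlgEquiv'.symm_apply_apply _
  have hψJ' : ψ J' = h' Complex.I := Matrix.toLinAlgEquiv'.symm_apply_apply _
  let G : (Matrix (Fin n) (Fin n) ℝ)ˣ :=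
    Units.map (ψ : Module.End ℝ (Fin n → ℝ) →* Matrix (Fin n) (Fin n) ℝ) (LinearMap.GeneralLinearGroup.ofLinearEquiv g)
  have hG : (G : Matrix (Fin n) (Fin n) ℝ) = ψ (g : Module.End ℝ (Fin n → ℝ)) := rfl
  have hGI : (G : Matrix (Fin n) (Fin n) ℝ) * h Complex.I = h' Complex.I * G := by
    have := congrArg ψ hgJ
    rwa [map_mul, map_mul, hψJ, hψJ', ← hG] at this
  refine ⟨G, fun z => ?_⟩
  have key : h' z * (G : Matrix (Fin n) (Fin n) ℝ) = G * h z := by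
    rw [algHom_complex_apply h z, algHom_complex_apply h' z, mul_add, add_mul, smul_mul_assoc, one_mul,
      mul_smul_comm, mul_one, smul_mul_assoc, mul_smul_comm, hGI]
  calc h' z = h' z * (G : Matrix (Fin n) (Fin n) ℝ) * (G⁻¹ : (Matrix (Fin n) (Fin n) ℝ)ˣ) :=
      (Units.mul_inv_cancel_right _ _).symm
    _ = G * h z * (G⁻¹ : (Matrix (Fin n) (Fin n) ℝ)ˣ) := by rw [key]

/-- **The case `D = ℝ` of p. 386 holds**: `ℝ`-algebra maps `ℂ → M_n(ℝ)` exist iff `n` is even, and any two are conjugate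
under `GL_n(ℝ)` («classifying isomorphism classes of `ℂ ⊗_ℝ D`-modules that are of rank `n` as `D`-modules. If `D = ℝ` then
`ℂ ⊗_ℝ D = ℂ`, and no `h` exists unless `n` is even, in which case it is unique up to inner automorphisms»).
[cite: Kottwitz1992, §4 (p. 386)] -/
theorem Kottwitz1992_4_class_real_holds : Kottwitz1992_4_class_real := fun _ =>
  ⟨⟨fun ⟨h⟩ => even_of_algHom h, nonempty_algHom_of_even⟩, exists_units_conj⟩

/-! ## ED. 2 — Lemma 4.1 (3): the group `{x ∈ C ⊗ ℂ | x x* = 1, h(i)⁻¹ x̄ h(i) = x}` is compact (p. 386, p0014 L20–L26) -/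

section CompactProof

universe u

variable {C : Type u} [Ring C] [Algebra ℝ C] [StarRing C]

/-- `h(i)* = h(ī) = −h(i)` for a `*`-homomorphism `h : ℂ → C`. [cite: Kottwitz1992, §4 (p. 385)] -/
theorem star_map_I (h : ℂ →⋆ₐ[ℝ] C) : star (h Complex.I) = -h Complex.I := by
  rw [← map_star, Complex.star_def, Complex.conj_I, map_neg]

/-- `h(i) h(i) = −1`. [cite: Kottwitz1992, §4 (p. 385)] -/
theorem map_I_mul_map_I (h : ℂ →⋆ₐ[ℝ] C) : h Complex.I * h Complex.I = -1 := by
  rw [← map_mul, Complex.I_mul_I, map_neg, map_one]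

/-- `h(i⁻¹) = −h(i)`. [cite: Kottwitz1992, §4 (p. 385)] -/
theorem map_inv_I (h : ℂ →⋆ₐ[ℝ] C) : h Complex.I⁻¹ = -h Complex.I := by
  rw [Complex.inv_I, map_neg]

/-- On elements commuting with `h(i)` the involution `ι = Int(h(i)⁻¹) ∘ *` is `*` itself: `a h(i) = h(i) a ⟹ ι(a) = a*`
(«`x′ = x*`» on the subgroup, p. 386 L21). [cite: Kottwitz1992, Lemma 4.1 (3) (p. 386)] -/
theorem iota_eq_star_of_comm (h : ℂ →⋆ₐ[ℝ] C) {a : C} (ha : a * h Complex.I = h Complex.I * a) :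
    iota h a = star a := by
  have h1 : h Complex.I * star a = star a * h Complex.I := by
    have := congrArg star ha
    rwa [star_mul, star_mul, star_map_I, neg_mul, mul_neg, neg_inj] at this
  rw [iota, map_inv_I, neg_mul, neg_mul, h1, mul_assoc, map_I_mul_map_I, mul_neg_one, neg_neg]

/-- On elements anticommuting with `h(i)`: `h(i) b = −b h(i) ⟹ ι(b) = −b*`. [cite: Kottwitz1992, Lemma 4.1 (3) (p. 386)] -/
theorem iota_eq_neg_star_of_anticomm (h : ℂ →⋆ₐ[ℝ] C) {b : C} (hb : h Complex.I * b = -(b * h Complex.I)) :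
    iota h b = -star b := by
  have h2 : h Complex.I * star b = -(star b * h Complex.I) := by
    have := congrArg star hb
    rw [star_neg, star_mul, star_mul, star_map_I, mul_neg, neg_mul, neg_neg] at this
    exact this.symm
  rw [iota, map_inv_I, neg_mul, neg_mul, h2, neg_mul, neg_neg, mul_assoc, map_I_mul_map_I, mul_neg_one]

/-- `ι` is `ℝ`-homogeneous: `ι(t x) = t ι(x)`. [cite: Kottwitz1992, §4 (p. 385)] -/
theorem iota_smul [StarModule ℝ C] (h : ℂ →⋆ₐ[ℝ] C) (t : ℝ) (x : C) : iota h (t • x) = t • iota h x := by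
  rw [iota, iota, star_smul, star_trivial, mul_smul_comm, smul_mul_assoc]

/-- The compactness mechanism of p. 386 («a closed subgroup of the orthogonal group of a positive definite symmetric
bilinear form» is compact): a closed subset `K` of a level set `{Q = d}` of a continuous, positive definite,
`2`-homogeneous function `Q` on a finite-dimensional Hausdorff real topological vector space `E` is compact — in linear
coordinates `E ≅ ℝ^m`, `Q ≥ μ ‖·‖²` with `μ > 0` the minimum of `Q` on the unit sphere, so the level set is bounded.
[cite: Kottwitz1992, Lemma 4.1 (3) (p. 386)] -/
theorem isCompact_of_subset_levelSet {E : Type*} [AddCommGroup E] [Module ℝ E] [TopologicalSpace E]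
    [IsTopologicalAddGroup E] [ContinuousSMul ℝ E] [T2Space E] [FiniteDimensional ℝ E] {Q : E → ℝ}
    (hQc : Continuous Q) (hQ2 : ∀ (t : ℝ) (v : E), Q (t • v) = t ^ 2 * Q v) (hQpos : ∀ v, v ≠ 0 → 0 < Q v)
    {d : ℝ} {K : Set E} (hK : IsClosed K) (hKQ : ∀ v ∈ K, Q v = d) : IsCompact K := by
  let φ : E ≃L[ℝ] (Fin (finrank ℝ E) → ℝ) := ContinuousLinearEquiv.ofFinrankEq (by rw [Module.finrank_fin_fun])
  have hsph : ∀ w : Fin (finrank ℝ E) → ℝ, 1 < ‖w‖ → ‖w‖⁻¹ • w ∈ Metric.sphere (0 : Fin (finrank ℝ E) → ℝ) 1 :=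
    fun w hw => by
      rw [mem_sphere_zero_iff_norm, norm_smul, norm_inv, norm_norm, inv_mul_cancel₀ (zero_lt_one.trans hw).ne']
  -- a radius bounding the level set `{Q ∘ φ⁻¹ = d}` in the model `ℝ^m`
  obtain ⟨R, hR⟩ : ∃ R : ℝ, ∀ w : Fin (finrank ℝ E) → ℝ, Q (φ.symm w) = d → ‖w‖ ≤ R := by
    by_cases hs : (Metric.sphere (0 : Fin (finrank ℝ E) → ℝ) 1).Nonempty
    · obtain ⟨u₀, hu₀, hmin⟩ := (isCompact_sphere (0 : Fin (finrank ℝ E) → ℝ) 1).exists_isMinOn hs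
        (hQc.comp φ.symm.continuous).continuousOn
      have hu₀ne : φ.symm u₀ ≠ 0 := by
        intro h0
        have h0' : u₀ = 0 := by simpa using congrArg φ h0
        rw [h0', mem_sphere_zero_iff_norm, norm_zero] at hu₀
        exact zero_ne_one hu₀
      have hμ : 0 < Q (φ.symm u₀) := hQpos _ hu₀ne
      refine ⟨max 1 (d / Q (φ.symm u₀)), fun w hw => ?_⟩
      rcases le_or_gt ‖w‖ 1 with hw1 | hw1
      · exact hw1.trans (le_max_left _ _)
      · have hle : Q (φ.symm u₀) ≤ Q (φ.symm (‖w‖⁻¹ • w)) := (isMinOn_iff.1 hmin) _ (hsph w hw1)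
        have hn2 : 0 < ‖w‖ ^ 2 := by positivity
        rw [map_smul, hQ2, hw, inv_pow, ← div_eq_inv_mul, le_div_iff₀ hn2] at hle
        have h3 : ‖w‖ ^ 2 ≤ d / Q (φ.symm u₀) := by
          rw [le_div_iff₀ hμ, mul_comm]
          exact hle
        calc ‖w‖ ≤ ‖w‖ ^ 2 := le_self_pow₀ hw1.le two_ne_zero
          _ ≤ d / Q (φ.symm u₀) := h3
          _ ≤ max 1 (d / Q (φ.symm u₀)) := le_max_right _ _
    · refine ⟨1, fun w _ => ?_⟩
      by_contra hw
      exact hs ⟨_, hsph w (not_le.1 hw)⟩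
  have hsub : K ⊆ φ.symm '' Metric.closedBall (0 : Fin (finrank ℝ E) → ℝ) R := fun v hv =>
    ⟨φ v, by
      rw [Metric.mem_closedBall, dist_zero_right]
      exact hR _ (by rw [φ.symm_apply_apply]; exact hKQ v hv), φ.symm_apply_apply v⟩
  exact ((isCompact_closedBall (0 : Fin (finrank ℝ E) → ℝ) R).image φ.symm.continuous).of_isClosed_subset hK hsub

/-- **Lemma 4.1 (3) holds** (p. 386): assuming `ι` positive, the set `{x = a ⊗ 1 + b ⊗ i ∈ C ⊗_ℝ ℂ | x x* = 1,
h(i)⁻¹ x̄ h(i) = x}` — in the carpet's real coordinates `(a, b) ∈ C × C` — is compact.  As printed: on it `ι(a) = a*`,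
`ι(b) = −b*` (the twist makes `x′ = x*`), so `x x* = 1` gives `a ι(a) + b ι(b) = 1` and `tr(a ι(a)) + tr(b ι(b)) =
tr(1)`; this is a level set of the positive definite quadratic form `tr(a ι(a)) + tr(b ι(b))` of the positive involution
`ι`, closed since multiplication and `*` are continuous for the (unique Hausdorff, module) topology of the
finite-dimensional `C`, hence compact by `isCompact_of_subset_levelSet`. [cite: Kottwitz1992, Lemma 4.1 (3) (p. 386)] -/
theorem Kottwitz1992_4_1_3_compact_holds : Kottwitz1992_4_1_3_compact.{u} := by
  intro C _ _ _ _ _ _ _ _ _ _ h hpos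
  -- the finite-dimensional Hausdorff `C` carries the module topology, so it is a topological ring
  haveI : IsModuleTopology ℝ C := isModuleTopologyOfFiniteDimensional
  haveI : IsTopologicalRing C := IsModuleTopology.isTopologicalRing ℝ C
  -- `*` is `ℝ`-linear, hence continuous
  have hstar : Continuous (star : C → C) := by
    let sL : C →ₗ[ℝ] C :=
      { toFun := star
        map_add' := star_add
        map_smul' := fun r x => by rw [star_smul, star_trivial]; rfl }
    exact sL.continuous_of_finiteDimensional
  have hιc : Continuous (iota h) := by
    show Continuous fun x => h Complex.I⁻¹ * star x * h Complex.I
    exact (continuous_const.mul hstar).mul continuous_const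
  -- the trace functional `τ(x) = tr_{C/ℝ}(L_x)`
  let τ : C →ₗ[ℝ] ℝ := (LinearMap.trace ℝ C) ∘ₗ LinearMap.mul ℝ C
  have hτ : ∀ x : C, τ x = LinearMap.trace ℝ C (LinearMap.mulLeft ℝ x) := fun x =>
    congrArg (LinearMap.trace ℝ C) (LinearMap.ext fun _ => rfl)
  have hτc : Continuous τ := τ.continuous_of_finiteDimensional
  -- the quadratic form `Q(a, b) = tr(a ι(a)) + tr(b ι(b))` on `C × C`
  let Q : C × C → ℝ := fun p => τ (p.1 * iota h p.1) + τ (p.2 * iota h p.2)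
  have hQc : Continuous Q :=
    (hτc.comp (continuous_fst.mul (hιc.comp continuous_fst))).add
      (hτc.comp (continuous_snd.mul (hιc.comp continuous_snd)))
  have hQ2 : ∀ (t : ℝ) (p : C × C), Q (t • p) = t ^ 2 * Q p := fun t p => by
    simp only [Q, Prod.smul_fst, Prod.smul_snd, iota_smul, smul_mul_assoc, mul_smul_comm, smul_smul, map_smul,
      smul_eq_mul]
    ring
  have hq0 : ∀ y : C, 0 ≤ τ (y * iota h y) := fun y => by
    by_cases hy : y = 0
    · rw [hy, zero_mul, map_zero]
    · rw [hτ]; exact (hpos y hy).le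
  have hQpos : ∀ p : C × C, p ≠ 0 → 0 < Q p := fun p hp => by
    show 0 < τ (p.1 * iota h p.1) + τ (p.2 * iota h p.2)
    by_cases h1 : p.1 = 0
    · have h2 : p.2 ≠ 0 := fun h2 => hp (Prod.ext h1 h2)
      exact add_pos_of_nonneg_of_pos (hq0 _) (by rw [hτ]; exact hpos _ h2)
    · exact add_pos_of_pos_of_nonneg (by rw [hτ]; exact hpos _ h1) (hq0 _)
  -- the defining conditions are closed
  have hK : IsClosed {p : C × C | p.1 * star p.1 - p.2 * star p.2 = 1 ∧ p.1 * star p.2 + p.2 * star p.1 = 0 ∧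
      p.1 * h Complex.I = h Complex.I * p.1 ∧ h Complex.I * p.2 = -(p.2 * h Complex.I)} := by
    simp only [Set.setOf_and]
    refine (isClosed_eq ?_ continuous_const).inter ((isClosed_eq ?_ continuous_const).inter
      ((isClosed_eq ?_ ?_).inter (isClosed_eq ?_ ?_)))
    · exact (continuous_fst.mul (hstar.comp continuous_fst)).sub (continuous_snd.mul (hstar.comp continuous_snd))
    · exact (continuous_fst.mul (hstar.comp continuous_snd)).add (continuous_snd.mul (hstar.comp continuous_fst))
    · exact continuous_fst.mul continuous_const
    · exact continuous_const.mul continuous_fst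
    · exact continuous_const.mul continuous_snd
    · exact (continuous_snd.mul continuous_const).neg
  -- on the set, `Q = tr(1)`
  refine isCompact_of_subset_levelSet (d := τ 1) hQc hQ2 hQpos hK fun p hp => ?_
  obtain ⟨h1, -, h3, h4⟩ := hp
  show τ (p.1 * iota h p.1) + τ (p.2 * iota h p.2) = τ 1
  rw [← map_add, iota_eq_star_of_comm h h3, iota_eq_neg_star_of_anticomm h h4, mul_neg, ← sub_eq_add_neg, h1]

end CompactProof

end Literature.NumberTheory.Kottwitz1992.HermitianSymmetricSpacesHolds
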